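import Literature.Analysis.FluidPDE.CriticalRegularity
import HarnessLib

/-!
# Scale invariance of Koch–Tataru's path-space norm (companion of `CriticalRegularity.lean`)

Discharge of the named fact `Literature.Analysis.FluidPDE.eKochTataruNorm_nsRescale`, stated in
`Literature/Analysis/FluidPDE/CriticalRegularity.lean`, by
`Literature.Analysis.FluidPDE.eKochTataruNorm_nsRescale_holds`. Theorems only (no new
definitions); kept in its own companion file next to `CriticalRegularityProofs.lean` (which
collects the Besov-side consequences of the GKP statements) so that neither file grows past the
size budget.

## Source and statement

H. Koch, D. Tataru, *Well-posedness for the Navier–Stokes equations*, Adv. Math. 157 (2001)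
22–35, §1: the Navier–Stokes equations are invariant under the scaling
`u_λ(x, t) = λ u(λ x, λ² t)`, `p_λ = λ² p(λx, λ²t)`, and the solution space `X` with norm
`‖u‖_X = sup_t √t ‖u(t)‖_∞ + sup_{x, R>0} (|B(x,R)|⁻¹ ∫₀^{R²} ∫_{B(x,R)} |u|² dy dt)^{1/2}`
"is invariant with respect to the scaling". The vendored fact `eKochTataruNorm_nsRescale` is
exactly this: `eKochTataruNorm (nsRescale c u) = eKochTataruNorm u` for all `u : ℝ → E → E` and
`c > 0`, where `nsRescale c u t x = c • u (c² t) (c x)` and `eKochTataruNorm` is the `ℝ≥0∞`-valued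
rendering of `‖·‖_X` with the normalisation `R^{-d}`, `d = dim E`, of the Carleson part. The
paper gives no proof (it is a two-line change of variables); the Lean proof below is that
change of variables.

## Proof architecture

* `L^∞` part: `‖u_c(t)‖_∞ = c ‖u(c²t)(c ·)‖_∞ = c ‖u(c²t)‖_∞` because the dilation `y ↦ c y`
  pushes Lebesgue measure to the nonzero multiple `c^{-d} • volume` of itself
  (`Measure.map_addHaar_smul`) and essential suprema only see null sets
  (`MeasurableEmbedding.eLpNorm_map_measure`, no measurability of `u` needed); then
  `√t · c = √(c² t)` and the supremum over `t > 0` is reindexed along `t ↦ c² t`.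
* Carleson part: `‖u_c(t,y)‖² = c² ‖u(c²t)(cy)‖²`; the space substitution `y ↦ c y` on balls
  costs `c^{-d}` and moves `B(x,R)` to `B(cx, cR)`, the time substitution `t ↦ c² t` costs `c⁻²`
  and moves `(0, R²)` to `(0, (cR)²)` (`MeasurableEmbedding.lintegral_map` and
  `MeasurableEmbedding.restrict_map`, again with no measurability of `u`); with
  `R^{-d} c^{-d} = (cR)^{-d}` the Carleson term of `u_c` at `(x, R)` is the term of `u` at
  `(cx, cR)`, and the supremum over `x ∈ E`, `R > 0` is reindexed along `(x, R) ↦ (cx, cR)`.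

## Mathlib / tree search

Mathlib (used): `Measure.map_addHaar_smul`, `Real.map_volume_mul_left`,
`measurableEmbedding_const_smul₀`, `measurableEmbedding_mulLeft₀`,
`MeasurableEmbedding.eLpNorm_map_measure`, `MeasurableEmbedding.lintegral_map`,
`MeasurableEmbedding.restrict_map`, `eLpNormEssSup_ennreal_smul_measure`, `eLpNorm_const_smul`,
`lintegral_const_mul'`. Tree: the `ℝ³`-only dilation lemmas `lintegral_comp_smul_fin3`,
`setLIntegral_ball_comp_smul` (`TsaiLocalEnergyScaling`) and the general affine change of
variables `lintegral_comp_space_affine`, `setLIntegral_preimage_comp_space_affine`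
(`SpaceTimeRescaling`) live behind the weak-solution imports; the two dilation lemmas needed
here are re-proved for a general finite-dimensional inner product space in a few lines each
rather than importing that layer into the critical-spaces files.

## References

* H. Koch, D. Tataru, *Well-posedness for the Navier–Stokes equations*, Adv. Math. 157 (2001)
  22–35, §1 (scaling `u_λ`, the space `X`, "invariant with respect to the scaling").
  [cite: KochTataru2001]
-/

noncomputable section

open MeasureTheory Set Function Filter Metric
open scoped ENNReal NNReal

namespace Literature.Analysis.FluidPDE

/-! ## Dilation lemmas and the discharge -/

section KochTataruScaling

variable {E : Type*} [NormedAddCommGroup E] [InnerProductSpace ℝ E] [FiniteDimensional ℝ E]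
  [MeasurableSpace E] [BorelSpace E]

/-- Reindexing a supremum over `t > 0` along the bijection `t ↦ a t` of `(0, ∞)`, `a > 0`:
`sup_{t>0} F(a t) = sup_{t>0} F(t)`. [folklore] -/
theorem iSup_pos_comp_mul_left {α : Type*} [CompleteLattice α] (F : ℝ → α) {a : ℝ}
    (ha : 0 < a) : ⨆ (t : ℝ) (_ : 0 < t), F (a * t) = ⨆ (t : ℝ) (_ : 0 < t), F t := by
  apply le_antisymm
  · exact iSup₂_le fun t ht => le_iSup₂_of_le (a * t) (mul_pos ha ht) le_rfl
  · refine iSup₂_le fun t ht => le_iSup₂_of_le (a⁻¹ * t) (mul_pos (inv_pos.2 ha) ht) ?_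
    rw [mul_inv_cancel_left₀ ha.ne']

omit [FiniteDimensional ℝ E] [MeasurableSpace E] [BorelSpace E] in
/-- Reindexing a supremum over centres `x : E` and radii `R > 0` along the bijection
`(x, R) ↦ (c x, c R)` of `E × (0, ∞)`, `c > 0`:
`sup_{x, R>0} F(c x, c R) = sup_{x, R>0} F(x, R)`. [folklore] -/
theorem iSup_iSup_pos_comp_smul {α : Type*} [CompleteLattice α] (F : E → ℝ → α) {c : ℝ}
    (hc : 0 < c) :
    ⨆ (x : E) (R : ℝ) (_ : 0 < R), F (c • x) (c * R) = ⨆ (x : E) (R : ℝ) (_ : 0 < R), F x R := by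
  apply le_antisymm
  · exact iSup_le fun x => iSup₂_le fun R hR =>
      le_iSup_of_le (c • x) (le_iSup₂_of_le (c * R) (mul_pos hc hR) le_rfl)
  · refine iSup_le fun x => iSup₂_le fun R hR =>
      le_iSup_of_le (c⁻¹ • x) (le_iSup₂_of_le (c⁻¹ * R) (mul_pos (inv_pos.2 hc) hR) ?_)
    rw [smul_inv_smul₀ hc.ne', mul_inv_cancel_left₀ hc.ne']

/-- **Dilation invariance of the `L^∞` norm**: `‖f(c ·)‖_{L^∞} = ‖f‖_{L^∞}` for `c ≠ 0`. The
dilation `y ↦ c y` maps Lebesgue measure to the nonzero multiple `|c|^{-d} •` of itself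
(`Measure.map_addHaar_smul`), and essential suprema only see null sets; no measurability of `f`
is needed (`MeasurableEmbedding.eLpNorm_map_measure`). [folklore] -/
theorem eLpNorm_top_comp_smul {F : Type*} [NormedAddCommGroup F] (f : E → F) {c : ℝ}
    (hc : c ≠ 0) : eLpNorm (fun y => f (c • y)) ∞ volume = eLpNorm f ∞ volume := by
  have hme : MeasurableEmbedding (fun y : E => c • y) := measurableEmbedding_const_smul₀ hc
  have h1 : eLpNorm f ∞ (Measure.map (fun y : E => c • y) volume) =
      eLpNorm (f ∘ fun y : E => c • y) ∞ volume := hme.eLpNorm_map_measure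
  rw [Measure.map_addHaar_smul volume hc, eLpNorm_exponent_top, eLpNorm_exponent_top,
    eLpNormEssSup_ennreal_smul_measure
      (ENNReal.ofReal_pos.2 (abs_pos.2 (inv_ne_zero (pow_ne_zero _ hc)))).ne'] at h1
  rw [eLpNorm_exponent_top, eLpNorm_exponent_top]
  exact h1.symm

/-- **Dilation of a ball integral**: `∫⁻_{B(x,R)} G(c y) dy = c^{-d} ∫⁻_{B(c x, c R)} G`, `c > 0`,
`d = dim E` (push-forward of Lebesgue measure under `y ↦ c y`; no measurability of `G`
needed). [folklore] -/
theorem setLIntegral_ball_center_comp_smul (G : E → ℝ≥0∞) {c : ℝ} (hc : 0 < c) (x : E) (R : ℝ) :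
    ∫⁻ y in ball x R, G (c • y) =
      ENNReal.ofReal ((c ^ Module.finrank ℝ E)⁻¹) * ∫⁻ y in ball (c • x) (c * R), G y := by
  have hme : MeasurableEmbedding (fun y : E => c • y) := measurableEmbedding_const_smul₀ hc.ne'
  have hpre : (fun y : E => c • y) ⁻¹' ball (c • x) (c * R) = ball x R := by
    ext y
    rw [mem_preimage, mem_ball, mem_ball, dist_smul₀, Real.norm_eq_abs, abs_of_pos hc,
      mul_lt_mul_iff_right₀ hc]
  have h1 := hme.restrict_map (volume : Measure E) (ball (c • x) (c * R))
  have h2 := hme.lintegral_map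
    (μ := (volume : Measure E).restrict ((fun y : E => c • y) ⁻¹' ball (c • x) (c * R))) G
  rw [hpre] at h1 h2
  rw [← h2, ← h1, Measure.map_addHaar_smul volume hc.ne', Measure.restrict_smul,
    lintegral_smul_measure, smul_eq_mul, abs_of_pos (inv_pos.2 (pow_pos hc _))]

/-- **Dilation of a time integral**: `∫⁻_{(0, R²)} H(c² t) dt = c⁻² ∫⁻_{(0, (cR)²)} H`, `c > 0`
(push-forward of Lebesgue measure under `t ↦ c² t`; no measurability of `H` needed). [folklore] -/
theorem setLIntegral_Ioo_comp_sq_mul (H : ℝ → ℝ≥0∞) {c : ℝ} (hc : 0 < c) (R : ℝ) :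
    ∫⁻ t in Ioo 0 (R ^ 2), H (c ^ 2 * t) =
      ENNReal.ofReal ((c ^ 2)⁻¹) * ∫⁻ t in Ioo 0 ((c * R) ^ 2), H t := by
  have hc2 : 0 < c ^ 2 := by positivity
  have hme : MeasurableEmbedding (fun t : ℝ => c ^ 2 * t) := measurableEmbedding_mulLeft₀ hc2.ne'
  have hpre : (fun t : ℝ => c ^ 2 * t) ⁻¹' Ioo 0 ((c * R) ^ 2) = Ioo 0 (R ^ 2) := by
    ext t
    rw [mem_preimage, mem_Ioo, mem_Ioo, mul_pow, mul_pos_iff_of_pos_left hc2,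
      mul_lt_mul_iff_right₀ hc2]
  have h1 := hme.restrict_map (volume : Measure ℝ) (Ioo 0 ((c * R) ^ 2))
  have h2 := hme.lintegral_map
    (μ := (volume : Measure ℝ).restrict ((fun t : ℝ => c ^ 2 * t) ⁻¹' Ioo 0 ((c * R) ^ 2))) H
  rw [hpre] at h1 h2
  rw [← h2, ← h1, Real.map_volume_mul_left hc2.ne', Measure.restrict_smul,
    lintegral_smul_measure, smul_eq_mul, abs_of_pos (inv_pos.2 hc2)]

/-- **The Carleson numerator of the rescaled field** (the substitution `(t, y) ↦ (c² t, c y)` of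
Koch–Tataru 2001, §1): for `c > 0` and `u_c = nsRescale c u`,
`∫⁻_{(0,R²)} ∫⁻_{B(x,R)} ‖u_c(t,y)‖² dy dt = c^{-d} ∫⁻_{(0,(cR)²)} ∫⁻_{B(cx,cR)} ‖u(t,y)‖² dy dt`
(the factor `c²` of `‖u_c‖² = c² ‖u ∘ ⋯‖²` cancels the time Jacobian `c⁻²`). [cite: KochTataru2001, §1] -/
theorem setLIntegral_setLIntegral_enorm_sq_nsRescale (u : ℝ → E → E) {c : ℝ} (hc : 0 < c)
    (x : E) (R : ℝ) :
    ∫⁻ t in Ioo 0 (R ^ 2), ∫⁻ y in ball x R, ‖FluidPDE.nsRescale c u t y‖ₑ ^ 2 =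
      ENNReal.ofReal ((c ^ Module.finrank ℝ E)⁻¹) *
        ∫⁻ t in Ioo 0 ((c * R) ^ 2), ∫⁻ y in ball (c • x) (c * R), ‖u t y‖ₑ ^ 2 := by
  have hc2 : ENNReal.ofReal c ^ 2 ≠ ∞ := ENNReal.pow_ne_top ENNReal.ofReal_ne_top
  have hpt : ∀ t y, ‖FluidPDE.nsRescale c u t y‖ₑ ^ 2 =
      ENNReal.ofReal c ^ 2 * ‖u (c ^ 2 * t) (c • y)‖ₑ ^ 2 := by
    intro t y
    rw [FluidPDE.nsRescale_apply, enorm_smul, mul_pow, Real.enorm_eq_ofReal hc.le]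
  have step1 : ∀ t, ∫⁻ y in ball x R, ‖FluidPDE.nsRescale c u t y‖ₑ ^ 2 =
      ENNReal.ofReal c ^ 2 * (ENNReal.ofReal ((c ^ Module.finrank ℝ E)⁻¹) *
        ∫⁻ y in ball (c • x) (c * R), ‖u (c ^ 2 * t) y‖ₑ ^ 2) := by
    intro t
    simp_rw [hpt]
    rw [lintegral_const_mul' _ _ hc2,
      setLIntegral_ball_center_comp_smul (fun y => ‖u (c ^ 2 * t) y‖ₑ ^ 2) hc x R]
  simp_rw [step1]
  rw [lintegral_const_mul' _ _ hc2, lintegral_const_mul' _ _ ENNReal.ofReal_ne_top,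
    setLIntegral_Ioo_comp_sq_mul (fun t => ∫⁻ y in ball (c • x) (c * R), ‖u t y‖ₑ ^ 2) hc R,
    ← mul_assoc, ← mul_assoc]
  congr 1
  rw [mul_right_comm, ← ENNReal.ofReal_pow hc.le, ← ENNReal.ofReal_mul (by positivity),
    mul_inv_cancel₀ (by positivity), ENNReal.ofReal_one, one_mul]

/-- **Discharge of `eKochTataruNorm_nsRescale`** (Koch–Tataru 2001, §1: "`X` is invariant with
respect to the scaling"): `‖nsRescale c u‖_X = ‖u‖_X` for every field `u : ℝ → E → E` and every
`c > 0`. Both summands of `eKochTataruNorm` are separately invariant: for the `L^∞` part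
`√t ‖u_c(t)‖_∞ = √t · c ‖u(c²t)(c ·)‖_∞ = √(c²t) ‖u(c²t)‖_∞` (`eLpNorm_top_comp_smul`), and for
the Carleson part the term of `u_c` at `(x, R)` equals the term of `u` at `(c x, c R)`
(`setLIntegral_setLIntegral_enorm_sq_nsRescale` and `R^{-d} c^{-d} = (cR)^{-d}`); the suprema are
then reindexed along `t ↦ c² t` and `(x, R) ↦ (c x, c R)` (`iSup_pos_comp_mul_left`,
`iSup_iSup_pos_comp_smul`). [cite: KochTataru2001, §1] -/
theorem eKochTataruNorm_nsRescale_holds : eKochTataruNorm_nsRescale (E := E) := by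
  intro u c hc
  have hc0 : c ≠ 0 := hc.ne'
  unfold eKochTataruNorm
  congr 1
  · have hslice : ∀ t : ℝ,
        ENNReal.ofReal (Real.sqrt t) * eLpNorm (FluidPDE.nsRescale c u t) ∞ volume =
          ENNReal.ofReal (Real.sqrt (c ^ 2 * t)) * eLpNorm (u (c ^ 2 * t)) ∞ volume := by
      intro t
      have h1 : FluidPDE.nsRescale c u t = c • fun y => u (c ^ 2 * t) (c • y) := rfl
      have hsq : Real.sqrt t * c = Real.sqrt (c ^ 2 * t) := by
        rw [Real.sqrt_mul (sq_nonneg c), Real.sqrt_sq hc.le, mul_comm]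
      rw [h1, eLpNorm_const_smul, eLpNorm_top_comp_smul (u (c ^ 2 * t)) hc0, ← mul_assoc,
        Real.enorm_eq_ofReal hc.le, ← ENNReal.ofReal_mul (Real.sqrt_nonneg _), hsq]
    calc ⨆ (t : ℝ) (_ : 0 < t),
          ENNReal.ofReal (Real.sqrt t) * eLpNorm (FluidPDE.nsRescale c u t) ∞ volume
        = ⨆ (t : ℝ) (_ : 0 < t),
          ENNReal.ofReal (Real.sqrt (c ^ 2 * t)) * eLpNorm (u (c ^ 2 * t)) ∞ volume :=
          biSup_congr fun t _ => hslice t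
      _ = ⨆ (t : ℝ) (_ : 0 < t), ENNReal.ofReal (Real.sqrt t) * eLpNorm (u t) ∞ volume :=
          iSup_pos_comp_mul_left (fun t => ENNReal.ofReal (Real.sqrt t) * eLpNorm (u t) ∞ volume)
            (by positivity)
  · have hterm : ∀ (x : E) (R : ℝ), 0 < R →
        ((ENNReal.ofReal (R ^ Module.finrank ℝ E))⁻¹ *
            ∫⁻ t in Ioo 0 (R ^ 2), ∫⁻ y in ball x R, ‖FluidPDE.nsRescale c u t y‖ₑ ^ 2) ^
              (1 / 2 : ℝ) =
          ((ENNReal.ofReal ((c * R) ^ Module.finrank ℝ E))⁻¹ *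
            ∫⁻ t in Ioo 0 ((c * R) ^ 2), ∫⁻ y in ball (c • x) (c * R), ‖u t y‖ₑ ^ 2) ^
              (1 / 2 : ℝ) := by
      intro x R hR
      rw [setLIntegral_setLIntegral_enorm_sq_nsRescale u hc x R, ← mul_assoc]
      congr 2
      rw [ENNReal.ofReal_inv_of_pos (pow_pos hc _),
        ← ENNReal.mul_inv (Or.inr ENNReal.ofReal_ne_top) (Or.inl ENNReal.ofReal_ne_top),
        ← ENNReal.ofReal_mul (pow_nonneg hR.le _), mul_pow, mul_comm (c ^ Module.finrank ℝ E)]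
    calc ⨆ (x : E) (R : ℝ) (_ : 0 < R), ((ENNReal.ofReal (R ^ Module.finrank ℝ E))⁻¹ *
            ∫⁻ t in Ioo 0 (R ^ 2), ∫⁻ y in ball x R, ‖FluidPDE.nsRescale c u t y‖ₑ ^ 2) ^
              (1 / 2 : ℝ)
        = ⨆ (x : E) (R : ℝ) (_ : 0 < R), ((ENNReal.ofReal ((c * R) ^ Module.finrank ℝ E))⁻¹ *
            ∫⁻ t in Ioo 0 ((c * R) ^ 2), ∫⁻ y in ball (c • x) (c * R), ‖u t y‖ₑ ^ 2) ^
              (1 / 2 : ℝ) :=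
          iSup_congr fun x => biSup_congr fun R hR => hterm x R hR
      _ = ⨆ (x : E) (R : ℝ) (_ : 0 < R), ((ENNReal.ofReal (R ^ Module.finrank ℝ E))⁻¹ *
            ∫⁻ t in Ioo 0 (R ^ 2), ∫⁻ y in ball x R, ‖u t y‖ₑ ^ 2) ^ (1 / 2 : ℝ) :=
          iSup_iSup_pos_comp_smul (fun x R => ((ENNReal.ofReal (R ^ Module.finrank ℝ E))⁻¹ *
            ∫⁻ t in Ioo 0 (R ^ 2), ∫⁻ y in ball x R, ‖u t y‖ₑ ^ 2) ^ (1 / 2 : ℝ)) hc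

end KochTataruScaling

end Literature.Analysis.FluidPDE
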